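import Summits.QuantumAdvantage.QuantumAdvantage.Theorems.CertDialL
import HarnessLib

/-!
# CertDial — part M (§14b): ★★★ NINE LIGHTS — every CLUSTER-LOCAL answer map loses an odd-class input of weight `≤ 5`

With the nine lights of part L (shape `M`: block points `0, 1, M, 2M-1, 2M`; clusters LEFT `{0,1}`, MIDDLE `{M}`, RIGHT `{2M-1,2M}`):
an answer map `z` is CLUSTER-LOCAL (`NineClusterLocal M z`) when every row `b` answers alike all nine inputs having the same trace on ONE
cluster — `SeesLeft` / `SeesMid` / `SeesRight`, the view partitions being `{ν₁,ν₂,ν₉}{ν₃,ν₄,ν₅}{ν₆,ν₇,ν₈}` (LEFT),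
`{ν₃,ν₄,ν₆,ν₇,ν₉}{ν₁,ν₂,ν₅,ν₈}` (MIDDLE), `{ν₅,ν₈,ν₉}{ν₁,ν₃,ν₆}{ν₂,ν₄,ν₇}` (RIGHT) — where an odd row in `[M, 2M)` may not use the LEFT
view and an odd row below `M` may not use the RIGHT view (the two «admissibility» clauses; they are exactly what the electorates demand,
g29 `num/ninecore.py`).  A row reading the inputs through ANY set of positions that misses two of the three clusters has the third view
(`seesLeft_of_reads` …).  THE CERTIFICATE (`nine_lights`): row `b` lies in an even number of electorates within each view class
(`leftA_even` … `rightC_even`: finite parity checks, `omega`), so with equal answers inside a class the nine membership-with-answer counts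
have an even total (`even_blocks_*`) — against the odd target sum of part L.  Hence ★★★ `clusterLightLaw_five`: every cluster-local map
loses an odd-class input of weight `≤ 5`; and (`nine_lights_affine_winner`, via Thm B′ `no_bounded_universal_family`) some AFFINE strategy
wins all nine, so its answer map is not cluster-local.  Part N turns cluster-locality into concrete hypotheses (slit-local, antipodal-local,
window-local tables; the antipodes of §10–§12).  Imports part L.  Nothing here touches the weight-7 leaves or 27432.
`lean check` on the tree closure: rc 0, no warnings, no placeholders; axioms standard (`propext`, `Classical.choice`, `Quot.sound`).
-/

set_option linter.dupNamespace false
set_option linter.style.longLine false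

noncomputable section
open scoped Classical

namespace Summit.QuantumAdvantage.QuantumAdvantage.Theorems.CertDial
open Finset
open Literature.Computability.QuantumComplexity Literature.Computability.QuantumComplexity.RingHLF
open Summit.QuantumAdvantage.AdviceFreeQNC0
open Literature.Computability.MetaComplexity Literature.Computability.MetaComplexity.Smolensky
open Summit.QuantumAdvantage.QuantumAdvantage.Theorems.ParityDial (par offs)

variable {n : ℕ}

/-! ### §14b Cluster views, the parity bookkeeping, and the theorem -/

/-- row `b` of `z` answers alike all nine lights with the same trace on the LEFT cluster `{0,1}`
(view classes `{ν₁, ν₂, ν₉} ⊇ {0,1}`, `{ν₃, ν₄, ν₅} ∋ 0` only, `{ν₆, ν₇, ν₈} ∋ 1` only). -/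
def SeesLeft (M : ℕ) (z : (Fin n → Bool) → Fin n → Bool) (b : Fin n) : Prop :=
  z (lamp₁ n M) b = z (lamp₂ n M) b ∧ z (lamp₁ n M) b = z (pentIn n M) b ∧
  z (lamp₃ n M) b = z (lamp₄ n M) b ∧ z (lamp₃ n M) b = z (lamp₅ n M) b ∧
  z (lamp₆ n M) b = z (lamp₇ n M) b ∧ z (lamp₆ n M) b = z (lamp₈ n M) b

/-- … with the same trace on the MIDDLE cluster `{M}` (classes `{ν₃, ν₄, ν₆, ν₇, ν₉} ∋ M`, `{ν₁, ν₂, ν₅, ν₈} ∌ M`). -/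
def SeesMid (M : ℕ) (z : (Fin n → Bool) → Fin n → Bool) (b : Fin n) : Prop :=
  z (lamp₃ n M) b = z (lamp₄ n M) b ∧ z (lamp₃ n M) b = z (lamp₆ n M) b ∧ z (lamp₃ n M) b = z (lamp₇ n M) b ∧
  z (lamp₃ n M) b = z (pentIn n M) b ∧
  z (lamp₁ n M) b = z (lamp₂ n M) b ∧ z (lamp₁ n M) b = z (lamp₅ n M) b ∧ z (lamp₁ n M) b = z (lamp₈ n M) b

/-- … with the same trace on the RIGHT cluster `{2M-1, 2M}` (classes `{ν₅, ν₈, ν₉} ⊇ {2M-1, 2M}`, `{ν₁, ν₃, ν₆} ∋ 2M-1` only,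
`{ν₂, ν₄, ν₇} ∋ 2M` only). -/
def SeesRight (M : ℕ) (z : (Fin n → Bool) → Fin n → Bool) (b : Fin n) : Prop :=
  z (lamp₅ n M) b = z (lamp₈ n M) b ∧ z (lamp₅ n M) b = z (pentIn n M) b ∧
  z (lamp₁ n M) b = z (lamp₃ n M) b ∧ z (lamp₁ n M) b = z (lamp₆ n M) b ∧
  z (lamp₂ n M) b = z (lamp₄ n M) b ∧ z (lamp₂ n M) b = z (lamp₇ n M) b

/-- CLUSTER-LOCALITY of an answer map w.r.t. the nine lights of shape `M`: every row sees the nine through one cluster; an odd row in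
`[M, 2M)` (i.e. strictly between MIDDLE and RIGHT, `M` being even) only through MIDDLE or RIGHT, an odd row below `M` only through
LEFT or MIDDLE. -/
def NineClusterLocal (M : ℕ) (z : (Fin n → Bool) → Fin n → Bool) : Prop :=
  ∀ b : Fin n, SeesMid M z b ∨ (SeesLeft M z b ∧ ((b : ℕ) % 2 = 1 → M ≤ (b : ℕ) → 2 * M ≤ (b : ℕ))) ∨
    (SeesRight M z b ∧ ((b : ℕ) % 2 = 1 → M ≤ (b : ℕ)))

/-- a row that reads (through ANY read-set `R`) none of `M, 2M-1, 2M` sees the nine through the LEFT cluster. -/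
theorem seesLeft_of_reads {M : ℕ} {z : (Fin n → Bool) → Fin n → Bool} {b : Fin n} {R : Fin n → Prop} (hM : 2 ≤ M)
    (hread : ∀ x x' : Fin n → Bool, (∀ d : Fin n, R d → x d = x' d) → z x b = z x' b)
    (hR : ∀ d : Fin n, R d → (d : ℕ) ≠ M ∧ (d : ℕ) ≠ 2 * M - 1 ∧ (d : ℕ) ≠ 2 * M) : SeesLeft M z b := by
  refine ⟨?_, ?_, ?_, ?_, ?_, ?_⟩ <;> refine hread _ _ fun d hd => ?_ <;> have h := hR d hd <;>
    simp only [lamp₁, lamp₂, lamp₃, lamp₄, lamp₅, lamp₆, lamp₇, lamp₈, pentIn, trip, decide_eq_decide] <;> omega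

/-- a row that reads none of `0, 1, 2M-1, 2M` sees the nine through the MIDDLE cluster. -/
theorem seesMid_of_reads {M : ℕ} {z : (Fin n → Bool) → Fin n → Bool} {b : Fin n} {R : Fin n → Prop} (hM : 2 ≤ M)
    (hread : ∀ x x' : Fin n → Bool, (∀ d : Fin n, R d → x d = x' d) → z x b = z x' b)
    (hR : ∀ d : Fin n, R d → (d : ℕ) ≠ 0 ∧ (d : ℕ) ≠ 1 ∧ (d : ℕ) ≠ 2 * M - 1 ∧ (d : ℕ) ≠ 2 * M) : SeesMid M z b := by
  refine ⟨?_, ?_, ?_, ?_, ?_, ?_, ?_⟩ <;> refine hread _ _ fun d hd => ?_ <;> have h := hR d hd <;>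
    simp only [lamp₁, lamp₂, lamp₃, lamp₄, lamp₅, lamp₆, lamp₇, lamp₈, pentIn, trip, decide_eq_decide] <;> omega

/-- a row that reads none of `0, 1, M` sees the nine through the RIGHT cluster. -/
theorem seesRight_of_reads {M : ℕ} {z : (Fin n → Bool) → Fin n → Bool} {b : Fin n} {R : Fin n → Prop} (hM : 2 ≤ M)
    (hread : ∀ x x' : Fin n → Bool, (∀ d : Fin n, R d → x d = x' d) → z x b = z x' b)
    (hR : ∀ d : Fin n, R d → (d : ℕ) ≠ 0 ∧ (d : ℕ) ≠ 1 ∧ (d : ℕ) ≠ M) : SeesRight M z b := by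
  refine ⟨?_, ?_, ?_, ?_, ?_, ?_⟩ <;> refine hread _ _ fun d hd => ?_ <;> have h := hR d hd <;>
    simp only [lamp₁, lamp₂, lamp₃, lamp₄, lamp₅, lamp₆, lamp₇, lamp₈, pentIn, trip, decide_eq_decide] <;> omega

/-- bookkeeping: the indicator of a conjunction is the product of the indicators. -/
theorem ite_and_one (p q : Prop) [Decidable p] [Decidable q] :
    (if p ∧ q then (1 : ℕ) else 0) = (if p then 1 else 0) * (if q then 1 else 0) := by
  by_cases hp : p <;> by_cases hq : q <;> simp [hp, hq]

/-- bookkeeping (LEFT view): blocks `{1,2,9}`, `{3,4,5}`, `{6,7,8}` with even coefficient sums give an even total. -/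
theorem even_blocks_left {a₁ a₂ a₃ a₄ a₅ a₆ a₇ a₈ a₉ U V W : ℕ} (hA : Even (a₁ + a₂ + a₉)) (hB : Even (a₃ + a₄ + a₅))
    (hC : Even (a₆ + a₇ + a₈)) : Even (a₁ * U + a₂ * U + a₃ * V + a₄ * V + a₅ * V + a₆ * W + a₇ * W + a₈ * W + a₉ * U) := by
  rw [show a₁ * U + a₂ * U + a₃ * V + a₄ * V + a₅ * V + a₆ * W + a₇ * W + a₈ * W + a₉ * U =
      (a₁ + a₂ + a₉) * U + (a₃ + a₄ + a₅) * V + (a₆ + a₇ + a₈) * W by ring]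
  exact ((hA.mul_right _).add (hB.mul_right _)).add (hC.mul_right _)

/-- bookkeeping (MIDDLE view): blocks `{3,4,6,7,9}`, `{1,2,5,8}`. -/
theorem even_blocks_mid {a₁ a₂ a₃ a₄ a₅ a₆ a₇ a₈ a₉ U V : ℕ} (hA : Even (a₃ + a₄ + a₆ + a₇ + a₉)) (hB : Even (a₁ + a₂ + a₅ + a₈)) :
    Even (a₁ * V + a₂ * V + a₃ * U + a₄ * U + a₅ * V + a₆ * U + a₇ * U + a₈ * V + a₉ * U) := by
  rw [show a₁ * V + a₂ * V + a₃ * U + a₄ * U + a₅ * V + a₆ * U + a₇ * U + a₈ * V + a₉ * U =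
      (a₃ + a₄ + a₆ + a₇ + a₉) * U + (a₁ + a₂ + a₅ + a₈) * V by ring]
  exact (hA.mul_right _).add (hB.mul_right _)

/-- bookkeeping (RIGHT view): blocks `{5,8,9}`, `{1,3,6}`, `{2,4,7}`. -/
theorem even_blocks_right {a₁ a₂ a₃ a₄ a₅ a₆ a₇ a₈ a₉ U V W : ℕ} (hA : Even (a₅ + a₈ + a₉)) (hB : Even (a₁ + a₃ + a₆))
    (hC : Even (a₂ + a₄ + a₇)) : Even (a₁ * V + a₂ * W + a₃ * V + a₄ * W + a₅ * U + a₆ * V + a₇ * W + a₈ * U + a₉ * U) := by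
  rw [show a₁ * V + a₂ * W + a₃ * V + a₄ * W + a₅ * U + a₆ * V + a₇ * W + a₈ * U + a₉ * U =
      (a₅ + a₈ + a₉) * U + (a₁ + a₃ + a₆) * V + (a₂ + a₄ + a₇) * W by ring]
  exact ((hA.mul_right _).add (hB.mul_right _)).add (hC.mul_right _)

section Electorates
variable (M b : ℕ)

/-- LEFT view, class `{1,2,9}`: every row lies in an even number of `K₁, K₂, K₉`. -/
theorem leftA_even (hM : 2 ≤ M) : Even ((if b % 2 = 1 ∨ (1 ≤ b ∧ b ≤ 2 * M - 2) then 1 else 0) +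
    (if b % 2 = 0 ∨ 2 * M ≤ b then 1 else 0) + (if (b % 2 = 0 ∧ (b < 2 ∨ 2 * M - 2 < b)) ∨ (b % 2 = 1 ∧ b < 2 * M) then 1 else 0) : ℕ) := by
  rw [Nat.even_iff]; split_ifs <;> omega

/-- LEFT view, class `{3,4,5}` (row not odd in `[M, 2M)`). -/
theorem leftB_even (hadm : b % 2 = 1 → M ≤ b → 2 * M ≤ b) : Even ((if b % 2 = 0 ∨ b < M then 1 else 0) +
    (if b % 2 = 1 then 1 else 0) + (if b % 2 = 0 ∨ 2 * M ≤ b then 1 else 0) : ℕ) := by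
  rw [Nat.even_iff]; split_ifs <;> omega

/-- LEFT view, class `{6,7,8}` (row not odd in `[M, 2M)`). -/
theorem leftC_even (hM : 2 ≤ M) (hadm : b % 2 = 1 → M ≤ b → 2 * M ≤ b) :
    Even ((if b % 2 = 1 ∨ 2 * M - 1 ≤ b ∨ b = 0 then 1 else 0) + (if b % 2 = 0 ∨ (M ≤ b ∧ b < 2 * M) then 1 else 0) +
    (if b % 2 = 1 ∨ (1 ≤ b ∧ b ≤ 2 * M - 2) then 1 else 0) : ℕ) := by
  rw [Nat.even_iff]; split_ifs <;> omega

/-- MIDDLE view, class `{3,4,6,7,9}`: all rows. -/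
theorem midA_even (hM : 2 ≤ M) : Even ((if b % 2 = 0 ∨ b < M then 1 else 0) + (if b % 2 = 1 then 1 else 0) +
    (if b % 2 = 1 ∨ 2 * M - 1 ≤ b ∨ b = 0 then 1 else 0) + (if b % 2 = 0 ∨ (M ≤ b ∧ b < 2 * M) then 1 else 0) +
    (if (b % 2 = 0 ∧ (b < 2 ∨ 2 * M - 2 < b)) ∨ (b % 2 = 1 ∧ b < 2 * M) then 1 else 0) : ℕ) := by
  rw [Nat.even_iff]; split_ifs <;> omega

/-- MIDDLE view, class `{1,2,5,8}`: all rows (`K₁ = K₈`, `K₂ = K₅`). -/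
theorem midB_even : Even ((if b % 2 = 1 ∨ (1 ≤ b ∧ b ≤ 2 * M - 2) then 1 else 0) + (if b % 2 = 0 ∨ 2 * M ≤ b then 1 else 0) +
    (if b % 2 = 0 ∨ 2 * M ≤ b then 1 else 0) + (if b % 2 = 1 ∨ (1 ≤ b ∧ b ≤ 2 * M - 2) then 1 else 0) : ℕ) := by
  rw [Nat.even_iff]; split_ifs <;> omega

/-- RIGHT view, class `{5,8,9}`: all rows. -/
theorem rightA_even (hM : 2 ≤ M) : Even ((if b % 2 = 0 ∨ 2 * M ≤ b then 1 else 0) +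
    (if b % 2 = 1 ∨ (1 ≤ b ∧ b ≤ 2 * M - 2) then 1 else 0) +
    (if (b % 2 = 0 ∧ (b < 2 ∨ 2 * M - 2 < b)) ∨ (b % 2 = 1 ∧ b < 2 * M) then 1 else 0) : ℕ) := by
  rw [Nat.even_iff]; split_ifs <;> omega

/-- RIGHT view, class `{1,3,6}` (row not odd below `M`). -/
theorem rightB_even (hM : 2 ≤ M) (hadm : b % 2 = 1 → M ≤ b) : Even ((if b % 2 = 1 ∨ (1 ≤ b ∧ b ≤ 2 * M - 2) then 1 else 0) +
    (if b % 2 = 0 ∨ b < M then 1 else 0) + (if b % 2 = 1 ∨ 2 * M - 1 ≤ b ∨ b = 0 then 1 else 0) : ℕ) := by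
  rw [Nat.even_iff]; split_ifs <;> omega

/-- RIGHT view, class `{2,4,7}` (row not odd below `M`). -/
theorem rightC_even (hadm : b % 2 = 1 → M ≤ b) : Even ((if b % 2 = 0 ∨ 2 * M ≤ b then 1 else 0) + (if b % 2 = 1 then 1 else 0) +
    (if b % 2 = 0 ∨ (M ≤ b ∧ b < 2 * M) then 1 else 0) : ℕ) := by
  rw [Nat.even_iff]; split_ifs <;> omega

end Electorates

/-- ★★★ NINE LIGHTS.  For even `n`, even `M ≥ 2`, `2M + 2 ≤ n`: every answer map that is cluster-local for the nine lights of shape `M`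
loses one of them. -/
theorem nine_lights (he : n % 2 = 0) {M : ℕ} (hM2 : M % 2 = 0) (hM : 2 ≤ M) (hMn : 2 * M + 2 ≤ n)
    (z : (Fin n → Bool) → Fin n → Bool) (hz : NineClusterLocal M z) :
    ¬ (Rel (lamp₁ n M) (z (lamp₁ n M)) ∧ Rel (lamp₂ n M) (z (lamp₂ n M)) ∧ Rel (lamp₃ n M) (z (lamp₃ n M)) ∧
       Rel (lamp₄ n M) (z (lamp₄ n M)) ∧ Rel (lamp₅ n M) (z (lamp₅ n M)) ∧ Rel (lamp₆ n M) (z (lamp₆ n M)) ∧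
       Rel (lamp₇ n M) (z (lamp₇ n M)) ∧ Rel (lamp₈ n M) (z (lamp₈ n M)) ∧ Rel (pentIn n M) (z (pentIn n M))) := by
  rintro ⟨H1, H2, H3, H4, H5, H6, H7, H8, H9⟩
  have h1 := (rel_lamp₁_iff he hM hMn _).1 H1
  have h2 := (rel_lamp₂_iff he hM2 hM hMn _).1 H2
  have h3 := (rel_lamp₃_iff he hM2 hM hMn _).1 H3
  have h4 := (rel_lamp₄_iff he hM2 hM hMn _).1 H4
  have h5 := (rel_lamp₅_iff he hM2 hM hMn _).1 H5
  have h6 := (rel_lamp₆_iff he hM2 hM hMn _).1 H6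
  have h7 := (rel_lamp₇_iff he hM2 hM hMn _).1 H7
  have h8 := (rel_lamp₈_iff he hM hMn _).1 H8
  have h9 := (rel_pent_iff he hM2 hM (by omega) _).1 H9
  -- the per-row membership count, with answers
  set N : Fin n → ℕ := fun b =>
    (if (((b : ℕ) % 2 = 1 ∨ (1 ≤ (b : ℕ) ∧ (b : ℕ) ≤ 2 * M - 2)) ∧ z (lamp₁ n M) b = true) then 1 else 0) +
    (if (((b : ℕ) % 2 = 0 ∨ 2 * M ≤ (b : ℕ)) ∧ z (lamp₂ n M) b = true) then 1 else 0) +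
    (if (((b : ℕ) % 2 = 0 ∨ (b : ℕ) < M) ∧ z (lamp₃ n M) b = true) then 1 else 0) +
    (if ((b : ℕ) % 2 = 1 ∧ z (lamp₄ n M) b = true) then 1 else 0) +
    (if (((b : ℕ) % 2 = 0 ∨ 2 * M ≤ (b : ℕ)) ∧ z (lamp₅ n M) b = true) then 1 else 0) +
    (if (((b : ℕ) % 2 = 1 ∨ 2 * M - 1 ≤ (b : ℕ) ∨ (b : ℕ) = 0) ∧ z (lamp₆ n M) b = true) then 1 else 0) +
    (if (((b : ℕ) % 2 = 0 ∨ (M ≤ (b : ℕ) ∧ (b : ℕ) < 2 * M)) ∧ z (lamp₇ n M) b = true) then 1 else 0) +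
    (if (((b : ℕ) % 2 = 1 ∨ (1 ≤ (b : ℕ) ∧ (b : ℕ) ≤ 2 * M - 2)) ∧ z (lamp₈ n M) b = true) then 1 else 0) +
    (if ((((b : ℕ) % 2 = 0 ∧ ((b : ℕ) < 2 ∨ 2 * M - 2 < (b : ℕ))) ∨ ((b : ℕ) % 2 = 1 ∧ (b : ℕ) < 2 * M)) ∧
      z (pentIn n M) b = true) then 1 else 0) with hN
  have hsum :
      (univ.filter fun b : Fin n => ((b : ℕ) % 2 = 1 ∨ (1 ≤ (b : ℕ) ∧ (b : ℕ) ≤ 2 * M - 2)) ∧ z (lamp₁ n M) b = true).card +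
      (univ.filter fun b : Fin n => ((b : ℕ) % 2 = 0 ∨ 2 * M ≤ (b : ℕ)) ∧ z (lamp₂ n M) b = true).card +
      (univ.filter fun b : Fin n => ((b : ℕ) % 2 = 0 ∨ (b : ℕ) < M) ∧ z (lamp₃ n M) b = true).card +
      (univ.filter fun b : Fin n => (b : ℕ) % 2 = 1 ∧ z (lamp₄ n M) b = true).card +
      (univ.filter fun b : Fin n => ((b : ℕ) % 2 = 0 ∨ 2 * M ≤ (b : ℕ)) ∧ z (lamp₅ n M) b = true).card +
      (univ.filter fun b : Fin n => ((b : ℕ) % 2 = 1 ∨ 2 * M - 1 ≤ (b : ℕ) ∨ (b : ℕ) = 0) ∧ z (lamp₆ n M) b = true).card +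
      (univ.filter fun b : Fin n => ((b : ℕ) % 2 = 0 ∨ (M ≤ (b : ℕ) ∧ (b : ℕ) < 2 * M)) ∧ z (lamp₇ n M) b = true).card +
      (univ.filter fun b : Fin n => ((b : ℕ) % 2 = 1 ∨ (1 ≤ (b : ℕ) ∧ (b : ℕ) ≤ 2 * M - 2)) ∧ z (lamp₈ n M) b = true).card +
      (univ.filter fun b : Fin n => (((b : ℕ) % 2 = 0 ∧ ((b : ℕ) < 2 ∨ 2 * M - 2 < (b : ℕ))) ∨ ((b : ℕ) % 2 = 1 ∧ (b : ℕ) < 2 * M)) ∧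
        z (pentIn n M) b = true).card = ∑ b : Fin n, N b := by
    simp only [hN, Finset.card_filter, Finset.sum_add_distrib]
  -- … is even row by row: the electorates containing `b`, grouped by equal answers, come in even blocks
  have heven : ∀ b : Fin n, Even (N b) := by
    intro b
    simp only [hN, ite_and_one]
    rcases hz b with ⟨e34, e36, e37, e39, e12, e15, e18⟩ | ⟨⟨e12, e19, e34, e35, e67, e68⟩, hadm⟩ | ⟨⟨e58, e59, e13, e16, e24, e27⟩, hadm⟩
    · rw [← e34, ← e36, ← e37, ← e39, ← e12, ← e15, ← e18]
      exact even_blocks_mid (midA_even M b hM) (midB_even M b)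
    · rw [← e12, ← e19, ← e34, ← e35, ← e67, ← e68]
      exact even_blocks_left (leftA_even M b hM) (leftB_even M b hadm) (leftC_even M b hM hadm)
    · rw [← e58, ← e59, ← e13, ← e16, ← e24, ← e27]
      exact even_blocks_right (rightA_even M b hM) (rightB_even M b hM hadm) (rightC_even M b hadm)
  have htot : Even (∑ b : Fin n, N b) := Finset.even_sum _ fun b _ => heven b
  rw [← hsum, Nat.even_iff] at htot
  omega

/-- ★★★ THE CLUSTER-LOCAL LIGHT LAW at weight 5: every cluster-local answer map (shape `M` even, `2 ≤ M`, `2M + 2 ≤ n`, `n` even)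
loses an odd-class input of weight `≤ 5`. -/
theorem clusterLightLaw_five (he : n % 2 = 0) {M : ℕ} (hM2 : M % 2 = 0) (hM : 2 ≤ M) (hMn : 2 * M + 2 ≤ n)
    (z : (Fin n → Bool) → Fin n → Bool) (hz : NineClusterLocal M z) : ∃ x : Fin n → Bool, OddZeros x ∧ LightDial.wt x ≤ 5 ∧ ¬ Rel x (z x) := by
  obtain ⟨⟨o1, w1⟩, ⟨o2, w2⟩, ⟨o3, w3⟩, ⟨o4, w4⟩, ⟨o5, w5⟩, ⟨o6, w6⟩, ⟨o7, w7⟩, ⟨o8, w8⟩, ⟨o9, w9⟩⟩ := nine_lights_light (n := n) he hM hMn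
  by_contra hall
  push Not at hall
  exact nine_lights he hM2 hM hMn z hz
    ⟨hall _ o1 w1, hall _ o2 w2, hall _ o3 w3, hall _ o4 w4, hall _ o5 w5, hall _ o6 w6, hall _ o7 w7, hall _ o8 w8, hall _ o9 w9⟩

/-- the nine lights as a `Fin 9`-indexed family. -/
def nineFamily (n M : ℕ) : Fin 9 → (Fin n → Bool) :=
  ![lamp₁ n M, lamp₂ n M, lamp₃ n M, lamp₄ n M, lamp₅ n M, lamp₆ n M, lamp₇ n M, lamp₈ n M, pentIn n M]

/-- ★ THE NINE LIGHTS SEPARATE «CLUSTER-LOCAL» FROM «AFFINE»: some AFFINE strategy wins all nine (Thm B′: a bounded family), and its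
answer map is therefore not cluster-local. -/
theorem nine_lights_affine_winner (he : n % 2 = 0) {M : ℕ} (hM2 : M % 2 = 0) (hM : 2 ≤ M) (hMn : 2 * M + 2 ≤ n) (hn' : 874 ≤ n) :
    ∃ P : Fin n → CubeFn (ZMod 3) n, (∀ i, P i ∈ lowDeg (ZMod 3) n 1) ∧ (∀ k : Fin 9, Rel (nineFamily n M k) (ans P (nineFamily n M k))) ∧
      ¬ NineClusterLocal M (ans P) := by
  obtain ⟨⟨o1, w1⟩, ⟨o2, w2⟩, ⟨o3, w3⟩, ⟨o4, w4⟩, ⟨o5, w5⟩, ⟨o6, w6⟩, ⟨o7, w7⟩, ⟨o8, w8⟩, ⟨o9, w9⟩⟩ := nine_lights_light (n := n) he hM hMn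
  have hall : ∀ k : Fin 9, OddZeros (nineFamily n M k) ∧ LightDial.wt (nineFamily n M k) ≤ 5 := by
    intro k; fin_cases k
    exacts [⟨o1, w1⟩, ⟨o2, w2⟩, ⟨o3, w3⟩, ⟨o4, w4⟩, ⟨o5, w5⟩, ⟨o6, w6⟩, ⟨o7, w7⟩, ⟨o8, w8⟩, ⟨o9, w9⟩]
  obtain ⟨P, hP, hwin⟩ := no_bounded_universal_family 9 5 (by omega) (by omega) le_rfl (univ.image (nineFamily n M))
    (Finset.card_image_le.trans (by simp)) (by
      intro x hx
      obtain ⟨k, _, rfl⟩ := Finset.mem_image.1 hx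
      exact hall k)
  have hw : ∀ k : Fin 9, Rel (nineFamily n M k) (ans P (nineFamily n M k)) := fun k => hwin _ (Finset.mem_image_of_mem _ (Finset.mem_univ k))
  exact ⟨P, hP, hw, fun hloc => nine_lights he hM2 hM hMn (ans P) hloc ⟨hw 0, hw 1, hw 2, hw 3, hw 4, hw 5, hw 6, hw 7, hw 8⟩⟩

/-! ### Axiom audit -/

/-- info: 'Summit.QuantumAdvantage.QuantumAdvantage.Theorems.CertDial.nine_lights' depends on axioms: [propext,
 Classical.choice,
 Quot.sound] -/
#guard_msgs in #print axioms nine_lights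

/-- info: 'Summit.QuantumAdvantage.QuantumAdvantage.Theorems.CertDial.clusterLightLaw_five' depends on axioms: [propext,
 Classical.choice,
 Quot.sound] -/
#guard_msgs in #print axioms clusterLightLaw_five

/-- info: 'Summit.QuantumAdvantage.QuantumAdvantage.Theorems.CertDial.nine_lights_affine_winner' depends on axioms: [propext,
 Classical.choice,
 Quot.sound] -/
#guard_msgs in #print axioms nine_lights_affine_winner

end Summit.QuantumAdvantage.QuantumAdvantage.Theorems.CertDial
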